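import Literature.NumberTheory.Sieve.QuadraticRootsLevelCycle
import HarnessLib

/-!
# Orbital weights: the geodesic transform of a kernel `e(η Re z)Ψ(Im z)` (`Δ > 0`)

Topic `Literature/NumberTheory/Sieve`, continuation of `QuadraticRootsLevelCycle.lean` (Tóth's
positive-discriminant case).  For a form `Q = [A, B, C]` with `A > 0`, `Δ > 0` the geodesic `S_Q`
is the semicircle of **centre** `x₀ = −B/(2A)` and **radius** `r = √Δ/(2A)`; in the parameter `t`
of `…LevelAxisParam` one has `Re P_Q(t) = x₀ + r(1 − t²)/(1 + t²)`, `Im P_Q(t) = 2rt/(1 + t²)`.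
Hence the integral of a kernel `φ(z) = e(η Re z) Ψ(Im z)` along the whole geodesic,
`W_φ(Q) = ∫_0^∞ φ(P_Q(t)) dt/t`, factors as `e(η x₀) · 𝒯_ηΨ(r)` with the **geodesic transform**
`𝒯_ηΨ(r) = ∫_0^∞ e(η r (1 − t²)/(1 + t²)) Ψ(2rt/(1 + t²)) dt/t` — the positive-discriminant
replacement for DFI's weight `F(2πh Im z) e(h Re z)` evaluated at a Heegner point; and
`𝒯_ηΨ(r) = 0` as soon as `Ψ` vanishes below a height `Y > r` (a geodesic of radius `r` does not
reach height `Y`).  Everything here is proved: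

* `center`, `radius`, `rootPlus_eq`, `rootMinus_eq`, `axisPtC_re_eq`, `axisPtC_im_eq`,
  `axisPtC_im_le` (`Im P_Q(t) ≤ r`);
* `geodTransform η Ψ r` and **`orbitalWeight_eq`**:
  `∫_{t>0} e(η Re P_Q(t)) Ψ(Im P_Q(t)) dt/t = e(η x₀) 𝒯_ηΨ(r)`;
* **`geodTransform_eq_zero_of_support`**: `Ψ = 0` on `(−∞, Y)` and `r < Y` ⇒ `𝒯_ηΨ(r) = 0`.

## References

* Á. Tóth, *Roots of quadratic congruences*, IMRN 2000, no. 14, 719–739 (sums over closed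
  geodesics; cite-only in the store, cf. [cite: Ngo2024, §1]). [cite: Toth2000, main theorem]
* W. Duke, J. B. Friedlander, H. Iwaniec, Ann. of Math. (2) 141 (1995), (13)–(14) p. 428 (the
  weight `F(2πh√D/an) e(hb/an)` of the negative-discriminant case). [cite: DukeFriedlanderIwaniec1995, (14) p. 428]
-/

noncomputable section

namespace Literature.NumberTheory.Sieve

open scoped MatrixGroups UpperHalfPlane
open Literature.NumberTheory.QuadraticFields.Quadratic (BinQF)
open UpperHalfPlane MeasureTheory

namespace RootForms

variable {Q : BinQF}

/-! ### Centre and radius -/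

/-- The centre `x₀ = −B/(2A)` of the geodesic semicircle. [folklore] -/
def center (Q : BinQF) : ℝ := -Q.b / (2 * Q.a)

/-- The radius `r = √Δ/(2A)` of the geodesic semicircle (positive for `A > 0`, `Δ > 0`). [folklore] -/
def radius (Q : BinQF) : ℝ := sqrtDisc Q / (2 * Q.a)

/-- `θ₊ = x₀ + r`. [folklore] -/
theorem rootPlus_eq (Q : BinQF) : rootPlus Q = center Q + radius Q := by
  rw [rootPlus, center, radius]; ring

/-- `θ₋ = x₀ − r`. [folklore] -/
theorem rootMinus_eq (Q : BinQF) : rootMinus Q = center Q - radius Q := by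
  rw [rootMinus, center, radius]; ring

/-- `r > 0` for `A > 0`, `Δ > 0`. [folklore] -/
theorem radius_pos (hA : 0 < Q.a) (hΔ : 0 < Q.disc) : 0 < radius Q := by
  rw [radius]
  have hA' : (0 : ℝ) < Q.a := by exact_mod_cast hA
  have := sqrtDisc_pos hΔ
  positivity

/-- **`Re P_Q(t) = x₀ + r (1 − t²)/(1 + t²)`.** [folklore] -/
theorem axisPtC_re_eq (Q : BinQF) (t : ℝ) :
    (axisPtC Q t).re = center Q + radius Q * ((1 - t ^ 2) / (1 + t ^ 2)) := by
  rw [axisPtC_re, rootPlus_eq, rootMinus_eq]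
  have : (1 + t ^ 2 : ℝ) ≠ 0 := by positivity
  field_simp
  ring

/-- **`Im P_Q(t) = 2 r t/(1 + t²)`.** [folklore] -/
theorem axisPtC_im_eq (Q : BinQF) (t : ℝ) :
    (axisPtC Q t).im = radius Q * (2 * t / (1 + t ^ 2)) := by
  rw [axisPtC_im, rootPlus_eq, rootMinus_eq]
  have : (1 + t ^ 2 : ℝ) ≠ 0 := by positivity
  field_simp
  ring

/-- `2t/(1 + t²) ≤ 1`. [folklore] -/
theorem two_mul_div_one_add_sq_le_one (t : ℝ) : 2 * t / (1 + t ^ 2) ≤ 1 := by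
  rw [div_le_one (by positivity)]
  nlinarith [sq_nonneg (t - 1)]

/-- **A geodesic of radius `r` stays below height `r`**: `Im P_Q(t) ≤ r` (`r ≥ 0`). [folklore] -/
theorem axisPtC_im_le (hr : 0 ≤ radius Q) (t : ℝ) : (axisPtC Q t).im ≤ radius Q := by
  rw [axisPtC_im_eq]
  calc radius Q * (2 * t / (1 + t ^ 2)) ≤ radius Q * 1 :=
        mul_le_mul_of_nonneg_left (two_mul_div_one_add_sq_le_one t) hr
    _ = radius Q := mul_one _

/-! ### The geodesic transform -/

/-- `e(x) = exp(2πix)`. [folklore] -/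
def eTwoPi (x : ℝ) : ℂ := Complex.exp (2 * Real.pi * Complex.I * x)

/-- `e(x + y) = e(x) e(y)`. [folklore] -/
theorem eTwoPi_add (x y : ℝ) : eTwoPi (x + y) = eTwoPi x * eTwoPi y := by
  rw [eTwoPi, eTwoPi, eTwoPi, ← Complex.exp_add]
  push_cast
  ring_nf

/-- The **geodesic transform** of a height profile `Ψ` at frequency `η`:
`𝒯_ηΨ(r) = ∫_{t>0} e(η r (1 − t²)/(1 + t²)) Ψ(2rt/(1 + t²)) dt/t` — the integral of
`e(η(Re z − x₀)) Ψ(Im z)` along a geodesic of radius `r` with respect to hyperbolic arc length.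
[cite: Toth2000, main theorem (sums over closed geodesics; cf. Ngo2024 §1)] -/
def geodTransform (η : ℝ) (Ψ : ℝ → ℂ) (r : ℝ) : ℂ :=
  ∫ t in Set.Ioi (0 : ℝ), eTwoPi (η * (r * ((1 - t ^ 2) / (1 + t ^ 2)))) *
    Ψ (r * (2 * t / (1 + t ^ 2))) / t

/-- **The orbital weight factors through centre and radius**: for the kernel
`φ(z) = e(η Re z) Ψ(Im z)`,
`∫_{t>0} φ(P_Q(t)) dt/t = e(η x₀) · 𝒯_ηΨ(r)`. [cite: Toth2000, main theorem (sums over closed geodesics; cf. Ngo2024 §1)] -/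
theorem orbitalWeight_eq (hA : 0 < Q.a) (hΔ : 0 < Q.disc) (η : ℝ) (Ψ : ℝ → ℂ) :
    ∫ t in Set.Ioi (0 : ℝ), eTwoPi (η * ((axisPt₀ Q hA hΔ t : ℍ) : ℂ).re) *
        Ψ ((axisPt₀ Q hA hΔ t : ℍ) : ℂ).im / t =
      eTwoPi (η * center Q) * geodTransform η Ψ (radius Q) := by
  rw [geodTransform, ← integral_const_mul]
  refine setIntegral_congr_fun measurableSet_Ioi fun t ht => ?_
  rw [coe_axisPt₀_of_pos hA hΔ ht, axisPtC_re_eq, axisPtC_im_eq, mul_add, eTwoPi_add]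
  ring

/-- **Support**: if `Ψ` vanishes below height `Y` and `r < Y` then `𝒯_ηΨ(r) = 0` (a geodesic of
radius `r` never reaches the support of `Ψ`). [cite: Toth2000, main theorem (sums over closed geodesics; cf. Ngo2024 §1)] -/
theorem geodTransform_eq_zero_of_support (η : ℝ) {Ψ : ℝ → ℂ} {Y r : ℝ} (hr0 : 0 ≤ r)
    (hΨ : ∀ y < Y, Ψ y = 0) (hr : r < Y) : geodTransform η Ψ r = 0 := by
  rw [geodTransform]
  refine setIntegral_eq_zero_of_forall_eq_zero fun t _ => ?_
  have h1 : r * (2 * t / (1 + t ^ 2)) ≤ r :=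
    (mul_le_mul_of_nonneg_left (two_mul_div_one_add_sq_le_one t) hr0).trans (mul_one r).le
  rw [hΨ _ (lt_of_le_of_lt h1 hr), mul_zero, zero_div]

/-- The orbital weight of a level form vanishes when its radius `√Δ/(2A)` is below the support
of `Ψ`, i.e. for `A > √Δ/(2Y)`: the sum over level forms is effectively finite.
[cite: Toth2000, main theorem (sums over closed geodesics; cf. Ngo2024 §1)] -/
theorem orbitalWeight_eq_zero_of_support (hA : 0 < Q.a) (hΔ : 0 < Q.disc) (η : ℝ) {Ψ : ℝ → ℂ}
    {Y : ℝ} (hΨ : ∀ y < Y, Ψ y = 0) (hr : radius Q < Y) :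
    ∫ t in Set.Ioi (0 : ℝ), eTwoPi (η * ((axisPt₀ Q hA hΔ t : ℍ) : ℂ).re) *
        Ψ ((axisPt₀ Q hA hΔ t : ℍ) : ℂ).im / t = 0 := by
  rw [orbitalWeight_eq hA hΔ, geodTransform_eq_zero_of_support η (radius_pos hA hΔ).le hΨ hr,
    mul_zero]

end RootForms

end Literature.NumberTheory.Sieve
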